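import Literature.Probability.RandomPlanarGeometry.SAWPulledLargeForceExpansionZdFourthSymbol
import HarnessLib

/-!
# Pulled SAW on `ℤ^{d+1}`: the two CENSUS LAWS behind the fourth symbol, REDUCED to two axis-class counts

Topic `Literature/Probability/RandomPlanarGeometry` (continues `SAWPulledLargeForceExpansionZdFourthSymbol.lean` — CAR G-R: the RESPONSE THEOREM
for `[d^{k−3}] c_k^{(d)}` and ★★★ `exists_polynomial_largeForceCoeffZd_thirdCoeff_of_census_laws`, Am. BC's law conditional on the census laws
(L1) `48·[d^{c−3}] c_c(ℤ^d) = −2^c(c³−12c²+59c−138)` (`c ≥ 5`) and (L2′) `48·[d^{c−3}] N_{c,c+2}(ℤ^{d+1}) = −2^c(c⁴−12c³+65c²−180c+198)` (`c ≥ 4`);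
uses `SAWCountZdTopCoefficients.lean`: the memory-2 axis-class device `memCount_two_eq_count_add_sum_choose`
(`c_{n,2}(ℤ^d) = c_n(ℤ^d) + Σ_{u ≤ n−2} C(d,u)·G_n(u)`, `G_n(u)` = the non-self-avoiding memory-2 walks of length `n` on `ℤ^u` using every axis) and
`memCount_two` (`c_{n,2} = 2d(2d−1)^{n−1}`); `SAWCountZdThirdCoefficient.lean`: ★★★ `exists_polynomial_count_topThree`;
`SAWPulledLargeForceExpansionZdCostPolynomial.lean`: the axis-class identity `costCoeffZd_eq_sum_choose_mul` (`N_{c,n}(ℤ^{d+1}) = Σ_u C(d,u)F_{c,n}(u)`);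
`SAWPulledLargeForceExpansionZdDegreeProfile.lean`: `card_allAxesClass_eq_zero_of_lt`; `SAWIrreducibleBridgeSpanTwoTopClassCount.lean`:
★★★ `card_spanTwoTopClass` (`F_{c,c+2}(c−2) = 2^{c−2}(c−2)!C(c−1,3)`); Mathlib's `descPochhammer`).

PRINTED CONTEXT (locators only; nothing below is quoted digit-for-digit). Madras–Slade (1993) §1.1 eq. (1.1.8) p. 5 (the `1/d` expansion of
`μ`), §1.2 p. 10 (memory-2 walks), §4.2 eq. (4.2.20)–(4.2.22) (cost of a bridge); Clisby–Liang–Slade (2007) §1.3 eq. (1)/(3). NOT IN PRINT (lane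
statements): everything below.

THIS FILE (lane «pcv-sawmu», a-p1 g20; all PROVED, standard axioms, NO definitions — every class count is an inline `Finset.card` of tree notions):
* `CountCensus` — the count polynomial explicitly (`P = 2X(2X−1)^{n−1} − Σ_{u<n−1}(G_n(u)/u!)·descPochhammer u`, interpolating `c_n(ℤ^d)` at every `d`;
  its coefficients at `d^{n−2}`, `d^{n−3}` via `[X^{u−1}] descPochhammer u = −C(u,2)`); ★★ `card_badClass_deficiency_two`: `G_n(n−2) =
  (n−2)!·2^{n−2}·(n−3)` for every `n ≥ 3` (FORCED by the third coefficient of CAR C — an unconditional corollary); ★★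
  `exists_polynomial_count_topFour_of_card_badClass`: IF `G_n(n−3) = (n−3)!·2^{n−3}·(n³ − 9n² + 29n − 40)` THEN `d ↦ c_n(ℤ^d)` has CAR C's top three
  coefficients AND `48·[d^{n−3}] c_n = −2^n(n³ − 12n² + 59n − 138)` — (L1) at `n`.
* `SpanTwoCensus` — ★★ `exists_polynomial_costCoeffZd_spanTwo_topFour_of_card`: IF the second axis class of the span-two cell numbers `F_{c,c+2}(c−3) =
  (c−3)!·2^{c−3}·(c⁵ − 12c⁴ + 59c³ − 162c² + 276c − 234)/6` THEN `d ↦ N_{c,c+2}(ℤ^{d+1})` has degree `≤ c − 2`, `[d^{c−2}] = C(c−1,3)2^{c−2}` AND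
  `48·[d^{c−3}] N_{c,c+2} = −2^c(c⁴ − 12c³ + 65c² − 180c + 198)` — (L2′) at `c`.
* `Assembly` — ★★★ `exists_polynomial_largeForceCoeffZd_thirdCoeff_of_axisClass_counts`: the two counts for all `n ≥ 5`, `c ≥ 4` ⟹ Am. BC's law
  `[d^{k−3}] c_k^{(d)} = (−1)^{k−1}2^{k−3}(k−3)(k−4)(5k²−35k+56)/12` for every `k ≥ 3` (with the top two coefficients and the degree).
WHAT THIS SETTLES: the registered law Am. BC now rests on exactly TWO FINITE-COMBINATORIAL COUNTING STATEMENTS about canonical axis words —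
`#{canonical bad memory-2 words of length n on n−3 axes} = n³ − 9n² + 29n − 40` (`n ≥ 5`; by loop signature `4(n−4)² + (n−5)²(n−3) + (n−4) + (n−5) +
4(n−5)`, verified by exhaustive enumeration for `n ≤ 10` in the lane) and `#{canonical second-class span-two bridge words of cost c} =
(c⁵−12c⁴+59c³−162c²+276c−234)/6` (`c ≥ 4`; verified `c ≤ 17`) — which are HYPOTHESES here (the next cars), and on nothing else.
[cite: MadrasSlade1993, §1.1 eq. (1.1.8) p. 5; §1.2 p. 10; §4.2 eq. (4.2.20)–(4.2.22)] [cite: ClisbyLiangSlade2007, §1.3 eq. (1)/(3)]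

Provenance: lane «pcv-sawmu», a-p1 g20 (2026-08-27); design `DESIGN-ZD-CENSUS-LAW-L1.md`, enumerator `badwords.py`. Data (not used in any proof):
`G₅(2) = 40 = c_{5,2}(ℤ²) − c₅(ℤ²)`, `G₆(3) = 1248`, `G₄(2) = 8` (deficiency two at `n = 4`); `F_{4,6}(1) = 2`, `canon(4…9) = 1, 16, 93, 332, 905, 2076`.
-/

noncomputable section

open Finset
open scoped BigOperators
open Literature.Probability.LatticeModels
open Literature.Probability.RandomPlanarGeometry.SAW

namespace Literature.Probability.RandomPlanarGeometry.SAW.Zd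

section Plumbing

/-- A rational polynomial is determined by its values on `ℕ`. [cite: MadrasSlade1993, §1.1 eq. (1.1.8) p. 5; lane plumbing] -/
private theorem cr_poly_ext {P Q : Polynomial ℚ} (h : ∀ d : ℕ, P.eval (d : ℚ) = Q.eval (d : ℚ)) : P = Q := by
  apply Polynomial.eq_of_infinite_eval_eq
  refine Set.Infinite.mono ?_ (Set.infinite_range_of_injective Nat.cast_injective)
  rintro x ⟨d, rfl⟩
  exact h d

/-- A rational polynomial is determined by its values on the positive integers. [cite: MadrasSlade1993, §1.1 eq. (1.1.8) p. 5; lane plumbing] -/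
private theorem cr_poly_ext_succ {P Q : Polynomial ℚ} (h : ∀ d : ℕ, P.eval ((d + 1 : ℕ) : ℚ) = Q.eval ((d + 1 : ℕ) : ℚ)) : P = Q := by
  apply Polynomial.eq_of_infinite_eval_eq
  have hinj : Function.Injective (fun d : ℕ => ((d + 1 : ℕ) : ℚ)) := fun a b hab => by
    have hab' : ((a + 1 : ℕ) : ℚ) = ((b + 1 : ℕ) : ℚ) := hab
    have : (a + 1 : ℕ) = b + 1 := by exact_mod_cast hab'
    omega
  refine Set.Infinite.mono ?_ (Set.infinite_range_of_injective hinj)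
  rintro x ⟨d, rfl⟩
  exact h d

/-- `descPochhammer ℚ u` is monic of degree `u`: `[X^u] = 1`. [cite: MadrasSlade1993, §1.1 eq. (1.1.8) p. 5; lane plumbing] -/
private theorem cr_descPochhammer_coeff_self (u : ℕ) : (descPochhammer ℚ u).coeff u = 1 := by
  have h := monic_descPochhammer ℚ u
  rw [Polynomial.Monic, Polynomial.leadingCoeff, descPochhammer_natDegree] at h
  exact h

/-- The second coefficient of the falling factorial: `[X^u] X(X−1)⋯(X−u) = −C(u+1, 2)`.
[cite: MadrasSlade1993, §1.1 eq. (1.1.8) p. 5; lane plumbing] -/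
private theorem cr_descPochhammer_coeff_pred (u : ℕ) : (descPochhammer ℚ (u + 1)).coeff u = -(((u + 1).choose 2 : ℕ) : ℚ) := by
  induction u with
  | zero => simp [descPochhammer_one]
  | succ u ih =>
    rw [descPochhammer_succ_right, mul_sub, Polynomial.coeff_sub, Polynomial.coeff_mul_X, ih,
      show ((u + 1 : ℕ) : Polynomial ℚ) = Polynomial.C ((u + 1 : ℕ) : ℚ) by rw [Polynomial.C_eq_natCast],
      Polynomial.coeff_mul_C, cr_descPochhammer_coeff_self, Nat.choose_succ_succ' (u + 1) 1, Nat.choose_one_right]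
    push_cast
    ring

/-- `[X^k] (2X − 1)^m = (−1)^{m−k} 2^k C(m,k)` (`k ≤ m`). [cite: MadrasSlade1993, §1.2 (p. 10); lane plumbing] -/
private theorem cr_coeff_twoX_sub_one_pow {m k : ℕ} (hk : k ≤ m) :
    ((Polynomial.C (2 : ℚ) * Polynomial.X - 1) ^ m).coeff k = (-1 : ℚ) ^ (m - k) * 2 ^ k * (m.choose k : ℕ) := by
  have hfac : Polynomial.C (2 : ℚ) * Polynomial.X - 1 = Polynomial.C (2 : ℚ) * (Polynomial.X + Polynomial.C (-1/2 : ℚ)) := by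
    rw [mul_add, ← map_mul]; norm_num
    rw [sub_eq_add_neg, ← map_one Polynomial.C, ← map_neg]
  rw [hfac, mul_pow, ← map_pow, Polynomial.coeff_C_mul, Polynomial.coeff_X_add_C_pow]
  obtain ⟨j, rfl⟩ : ∃ j, m = k + j := ⟨m - k, by omega⟩
  rw [Nat.add_sub_cancel_left, pow_add]
  have : (-1 / 2 : ℚ) ^ j * (2 : ℚ) ^ j = (-1) ^ j := by rw [← mul_pow]; norm_num
  linear_combination ((2 : ℚ) ^ k * ((k + j).choose k : ℕ)) * this

/-- `2·C(j,2) = j(j−1)` over `ℚ`. [cite: MadrasSlade1993, §1.1 eq. (1.1.8) p. 5; lane plumbing] -/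
private theorem cr_two_mul_choose_two (j : ℕ) : (2 : ℚ) * (j.choose 2 : ℕ) = (j : ℚ) * ((j : ℚ) - 1) := by
  induction j with
  | zero => simp
  | succ j ih =>
    rw [Nat.choose_succ_succ' j 1, Nat.choose_one_right]
    push_cast
    linear_combination ih

/-- `6·C(j,3) = j(j−1)(j−2)` over `ℚ`. [cite: MadrasSlade1993, §1.1 eq. (1.1.8) p. 5; lane plumbing] -/
private theorem cr_six_mul_choose_three (j : ℕ) :
    (6 : ℚ) * (j.choose 3 : ℕ) = (j : ℚ) * ((j : ℚ) - 1) * ((j : ℚ) - 2) := by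
  induction j with
  | zero => simp
  | succ j ih =>
    rw [Nat.choose_succ_succ' j 2]
    push_cast
    linear_combination ih + 3 * cr_two_mul_choose_two j

end Plumbing

section CountCensus

/-- `c_{n,2}(ℤ^d) = 2d(2d−1)^{n−1}` as rational numbers for `d ≥ 1`. [cite: MadrasSlade1993, §1.2 (p. 10); lane plumbing] -/
private theorem cr_memCount_two_cast (d : ℕ) {n : ℕ} (hn : 1 ≤ n) :
    (memCount (d + 1) 2 n : ℚ) = 2 * ((d + 1 : ℕ) : ℚ) * (2 * ((d + 1 : ℕ) : ℚ) - 1) ^ (n - 1) := by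
  rw [memCount_two (d + 1) hn]
  have h1 : 1 ≤ 2 * (d + 1) := by omega
  push_cast [Nat.cast_sub h1]
  ring

/-- ★ THE COUNT POLYNOMIAL, EXPLICITLY, with its top FOUR coefficients: for `n = l + 3`,
`c_n(ℤ^d) = 2d(2d−1)^{n−1} − Σ_{u<n−1} G_n(u)·d(d−1)⋯(d−u+1)/u!` (`memCount_two_eq_count_add_sum_choose`), and the polynomial
`P = 2X(2X−1)^{n−1} − Σ_{u<n−1} (G_n(u)/u!)·descPochhammer(u)` has `[X^{n−2}]P = 2^{n−2}C(n−1,2) − G_n(n−2)/(n−2)!` and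
`[X^{n−3}]P = −2^{n−3}C(n−1,3) − G_n(n−3)/(n−3)! + C(n−2,2)·G_n(n−2)/(n−2)!` (the falling factorial contributes its second coefficient
`−C(u,2)`); it interpolates `c_n` at every `d` (at `d ≥ 1` by construction, at `d = 0` by uniqueness against `exists_polynomial_count_topThree`).
[cite: MadrasSlade1993, §1.1 eq. (1.1.8) p. 5; §1.2 p. 10; lane lemma] -/
private theorem cr_count_poly (l : ℕ) :
    ∃ P : Polynomial ℚ, P.natDegree ≤ l + 3 ∧
      P.coeff (l + 1) = (2 : ℚ) ^ (l + 1) * (((l + 2).choose 2 : ℕ) : ℚ) -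
        (((memWalks (l + 1) 2 (l + 3)).filter fun (ω : ℕ → Site (l + 1)) =>
          (∃ i ≤ l + 3, ∃ j ≤ l + 3, i < j ∧ ω i = ω j) ∧ ∀ a : Fin (l + 1), ∃ i ≤ l + 3, ω i a ≠ (0 : ℤ)).card : ℚ) /
          ((l + 1).factorial : ℚ) ∧
      P.coeff l = -(2 : ℚ) ^ l * (((l + 2).choose 3 : ℕ) : ℚ) -
        (((memWalks l 2 (l + 3)).filter fun (ω : ℕ → Site l) =>
          (∃ i ≤ l + 3, ∃ j ≤ l + 3, i < j ∧ ω i = ω j) ∧ ∀ a : Fin l, ∃ i ≤ l + 3, ω i a ≠ (0 : ℤ)).card : ℚ) /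
          (l.factorial : ℚ) +
        (((l + 1).choose 2 : ℕ) : ℚ) * ((((memWalks (l + 1) 2 (l + 3)).filter fun (ω : ℕ → Site (l + 1)) =>
          (∃ i ≤ l + 3, ∃ j ≤ l + 3, i < j ∧ ω i = ω j) ∧ ∀ a : Fin (l + 1), ∃ i ≤ l + 3, ω i a ≠ (0 : ℤ)).card : ℚ) /
          ((l + 1).factorial : ℚ)) ∧
      ∀ d : ℕ, (count d (l + 3) : ℚ) = P.eval (d : ℚ) := by
  classical
  set G : ℕ → ℕ := fun u => ((memWalks u 2 (l + 3)).filter fun (ω : ℕ → Site u) =>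
    (∃ i ≤ l + 3, ∃ j ≤ l + 3, i < j ∧ ω i = ω j) ∧ ∀ a : Fin u, ∃ i ≤ l + 3, ω i a ≠ (0 : ℤ)).card with hG
  set R : Polynomial ℚ := (Polynomial.C (2 : ℚ) * Polynomial.X - 1) ^ (l + 2) with hR
  set B : Polynomial ℚ := ∑ u ∈ Finset.range (l + 2), Polynomial.C ((G u : ℚ) / (u.factorial : ℚ)) * descPochhammer ℚ u
    with hBdef
  set P : Polynomial ℚ := Polynomial.C 2 * (R * Polynomial.X) - B with hP
  -- `P` interpolates `c_{l+3}` at every `d ≥ 1`, hence equals CAR C's polynomial and interpolates at every `d`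
  have hevalB : ∀ d : ℕ, B.eval (d : ℚ) = ∑ u ∈ Finset.range (l + 2), (d.choose u : ℚ) * (G u : ℚ) := by
    intro d
    rw [hBdef, Polynomial.eval_finsetSum]
    refine Finset.sum_congr rfl fun u _ => ?_
    have hf : (u.factorial : ℚ) ≠ 0 := by exact_mod_cast u.factorial_ne_zero
    rw [Polynomial.eval_mul, Polynomial.eval_C, descPochhammer_eval_eq_descFactorial ℚ d u,
      Nat.descFactorial_eq_factorial_mul_choose, Nat.cast_mul, div_mul_eq_mul_div, mul_div_assoc,
      mul_div_cancel_left₀ _ hf, mul_comm]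
  have hevP : ∀ d : ℕ, (count (d + 1) (l + 3) : ℚ) = P.eval ((d + 1 : ℕ) : ℚ) := by
    intro d
    have hm1 : 1 ≤ l + 3 := by omega
    have hcount : (count (d + 1) (l + 3) : ℚ) =
        (memCount (d + 1) 2 (l + 3) : ℚ) - ∑ u ∈ Finset.range (l + 2), ((d + 1).choose u : ℚ) * (G u : ℚ) := by
      have h := memCount_two_eq_count_add_sum_choose (d + 1) hm1
      rw [show l + 3 - 1 = l + 2 by omega] at h
      rw [h]; push_cast; ring
    rw [hcount, cr_memCount_two_cast d hm1, show l + 3 - 1 = l + 2 by omega, hP, Polynomial.eval_sub, hevalB (d + 1),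
      Polynomial.eval_mul, Polynomial.eval_C, Polynomial.eval_mul, Polynomial.eval_X, hR, Polynomial.eval_pow, Polynomial.eval_sub,
      Polynomial.eval_mul, Polynomial.eval_C, Polynomial.eval_X, Polynomial.eval_one]
    ring
  obtain ⟨Q, -, -, -, -, hQev⟩ := exists_polynomial_count_topThree (show 3 ≤ l + 3 by omega)
  have hPQ : P = Q := cr_poly_ext_succ fun d => by rw [← hevP d, hQev (d + 1)]
  -- degrees and coefficients
  have hBcoeff : ∀ k u, u ∈ Finset.range (l + 2) → u < k →
      (Polynomial.C ((G u : ℚ) / (u.factorial : ℚ)) * descPochhammer ℚ u).coeff k = 0 := by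
    intro k u _ huk
    rw [Polynomial.coeff_C_mul, Polynomial.coeff_eq_zero_of_natDegree_lt, mul_zero]
    rw [descPochhammer_natDegree]; exact huk
  have hBdeg : B.natDegree ≤ l + 2 := by
    refine Polynomial.natDegree_sum_le_of_forall_le _ _ fun u hu => ?_
    calc (Polynomial.C ((G u : ℚ) / (u.factorial : ℚ)) * descPochhammer ℚ u).natDegree
        ≤ (descPochhammer ℚ u).natDegree := Polynomial.natDegree_C_mul_le _ _
      _ = u := descPochhammer_natDegree ℚ u
      _ ≤ l + 2 := by have := Finset.mem_range.1 hu; omega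
  -- `B`'s coefficients at `X^{l+1}` and `X^l`
  have hB1 : B.coeff (l + 1) = (G (l + 1) : ℚ) / ((l + 1).factorial : ℚ) := by
    rw [hBdef, Polynomial.finsetSum_coeff, Finset.sum_range_succ, Finset.sum_eq_zero (fun u hu => hBcoeff (l + 1) u
      (Finset.mem_range.2 (by have := Finset.mem_range.1 hu; omega)) (Finset.mem_range.1 hu)), zero_add,
      Polynomial.coeff_C_mul, cr_descPochhammer_coeff_self, mul_one]
  have hB0 : B.coeff l = (G l : ℚ) / (l.factorial : ℚ) - (((l + 1).choose 2 : ℕ) : ℚ) * ((G (l + 1) : ℚ) / ((l + 1).factorial : ℚ)) := by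
    rw [hBdef, Polynomial.finsetSum_coeff, Finset.sum_range_succ, Finset.sum_range_succ, Finset.sum_eq_zero (fun u hu => hBcoeff l u
      (Finset.mem_range.2 (by have := Finset.mem_range.1 hu; omega)) (Finset.mem_range.1 hu)), zero_add,
      Polynomial.coeff_C_mul, cr_descPochhammer_coeff_self, mul_one, Polynomial.coeff_C_mul, cr_descPochhammer_coeff_pred]
    ring
  -- `2X(2X−1)^{l+2}`'s coefficients
  have hA1 : (Polynomial.C (2 : ℚ) * (R * Polynomial.X)).coeff (l + 1) = (2 : ℚ) ^ (l + 1) * (((l + 2).choose 2 : ℕ) : ℚ) := by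
    rw [Polynomial.coeff_C_mul, Polynomial.coeff_mul_X, hR, cr_coeff_twoX_sub_one_pow (by omega : l ≤ l + 2),
      show l + 2 - l = 2 by omega, Nat.choose_symm_of_eq_add (by ring : l + 2 = 2 + l)]
    ring
  have hA0 : (Polynomial.C (2 : ℚ) * (R * Polynomial.X)).coeff l = -(2 : ℚ) ^ l * (((l + 2).choose 3 : ℕ) : ℚ) := by
    rcases l with _ | l
    · rw [Polynomial.coeff_C_mul, Polynomial.mul_coeff_zero, Polynomial.coeff_X_zero, mul_zero, mul_zero]
      norm_num
    · rw [Polynomial.coeff_C_mul, Polynomial.coeff_mul_X, hR, cr_coeff_twoX_sub_one_pow (by omega : l ≤ l + 1 + 2),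
        show l + 1 + 2 - l = 3 by omega, Nat.choose_symm_of_eq_add (by ring : l + 1 + 2 = 3 + l)]
      ring
  refine ⟨P, ?_, ?_, ?_, fun d => by rw [hPQ]; exact hQev d⟩
  · refine (Polynomial.natDegree_sub_le _ _).trans (max_le ?_ (hBdeg.trans (by omega)))
    refine (Polynomial.natDegree_C_mul_le _ _).trans (Polynomial.natDegree_mul_le.trans ?_)
    rw [Polynomial.natDegree_X, hR]
    have hB' : (Polynomial.C (2 : ℚ) * Polynomial.X - 1).natDegree ≤ 1 := by
      refine (Polynomial.natDegree_sub_le _ _).trans (max_le ?_ (by simp))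
      exact Polynomial.natDegree_C_mul_le _ _ |>.trans (by simp)
    have := Polynomial.natDegree_pow_le_of_le (l + 2) hB'
    omega
  · rw [hP, Polynomial.coeff_sub, hA1, hB1]
  · rw [hP, Polynomial.coeff_sub, hA0, hB0]
    ring

/-- ★★ THE DEFICIENCY-TWO CLASS COUNT (a corollary of the THIRD coefficient, `SAWCountZdThirdCoefficient`): the non-self-avoiding memory-2
walks of length `n = m + 3` on `ℤ^{m+1}` using every axis number `G_n(n−2) = (n−2)!·2^{n−2}·(n−3)` (the unit-square words with an
injective complement). [cite: MadrasSlade1993, §1.1 eq. (1.1.8) p. 5; §1.2 p. 10; lane theorem] -/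
theorem card_badClass_deficiency_two (m : ℕ) :
    (((memWalks (m + 1) 2 (m + 3)).filter fun (ω : ℕ → Site (m + 1)) =>
        (∃ i ≤ m + 3, ∃ j ≤ m + 3, i < j ∧ ω i = ω j) ∧ ∀ a : Fin (m + 1), ∃ i ≤ m + 3, ω i a ≠ (0 : ℤ)).card : ℚ) =
      ((m + 1).factorial : ℚ) * 2 ^ (m + 1) * m := by
  obtain ⟨P, hPdeg, hP1, -, hPev⟩ := cr_count_poly m
  obtain ⟨Q, -, -, -, hQ2, hQev⟩ := exists_polynomial_count_topThree (show 3 ≤ m + 3 by omega)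
  have hPQ : P = Q := cr_poly_ext fun d => by rw [← hPev d, hQev d]
  rw [show m + 3 - 2 = m + 1 by omega, ← hPQ, hP1] at hQ2
  have hf : ((m + 1).factorial : ℚ) ≠ 0 := by exact_mod_cast (m + 1).factorial_ne_zero
  have e2 := cr_two_mul_choose_two (m + 2)
  push_cast at hQ2 e2
  have key : ((((memWalks (m + 1) 2 (m + 3)).filter fun (ω : ℕ → Site (m + 1)) =>
        (∃ i ≤ m + 3, ∃ j ≤ m + 3, i < j ∧ ω i = ω j) ∧ ∀ a : Fin (m + 1), ∃ i ≤ m + 3, ω i a ≠ (0 : ℤ)).card : ℚ) /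
          ((m + 1).factorial : ℚ)) = 2 ^ (m + 1) * m := by
    linear_combination (-1 : ℚ) * hQ2 + (2 : ℚ) ^ m * e2
  rw [div_eq_iff hf] at key
  rw [key]; ring


/-- ★★ REDUCTION OF THE CENSUS LAW (L1) TO ONE AXIS-CLASS COUNT: for `n = l + 3`, IF the non-self-avoiding memory-2 walks of length `n` on
`ℤ^{n−3}` using every axis number `G_n(n−3) = (n−3)!·2^{n−3}·(n³ − 9n² + 29n − 40)` (equivalently: `n³ − 9n² + 29n − 40` canonical bad words),
THEN `d ↦ c_n(ℤ^d)` has the top three coefficients of `SAWCountZdThirdCoefficient` AND `48·[d^{n−3}] c_n(ℤ^d) = −2^n(n³ − 12n² + 59n − 138)`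
— the lane's law (L1) (`P₃`) at this `n`. (The deficiency-two count is supplied by `card_badClass_deficiency_two`.)
[cite: MadrasSlade1993, §1.1 eq. (1.1.8) p. 5; §1.2 p. 10; lane theorem] -/
theorem exists_polynomial_count_topFour_of_card_badClass (l : ℕ)
    (hG : (((memWalks l 2 (l + 3)).filter fun (ω : ℕ → Site l) =>
        (∃ i ≤ l + 3, ∃ j ≤ l + 3, i < j ∧ ω i = ω j) ∧ ∀ a : Fin l, ∃ i ≤ l + 3, ω i a ≠ (0 : ℤ)).card : ℚ) =
      (l.factorial : ℚ) * 2 ^ l * (((l : ℚ) + 3) ^ 3 - 9 * ((l : ℚ) + 3) ^ 2 + 29 * ((l : ℚ) + 3) - 40)) :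
    ∃ P : Polynomial ℚ, P.natDegree ≤ l + 3 ∧ P.coeff (l + 3) = (2 : ℚ) ^ (l + 3) ∧
      P.coeff (l + 2) = -(((l + 3 : ℕ) : ℚ) - 1) * 2 ^ (l + 2) ∧
      P.coeff (l + 1) = 2 ^ l * (((l + 3 : ℕ) : ℚ) ^ 2 - 5 * ((l + 3 : ℕ) : ℚ) + 8) ∧
      48 * P.coeff l = -(2 : ℚ) ^ (l + 3) * (((l + 3 : ℕ) : ℚ) ^ 3 - 12 * ((l + 3 : ℕ) : ℚ) ^ 2 + 59 * ((l + 3 : ℕ) : ℚ) - 138) ∧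
      ∀ d : ℕ, (count d (l + 3) : ℚ) = P.eval (d : ℚ) := by
  obtain ⟨P, -, -, hP0, hPev⟩ := cr_count_poly l
  obtain ⟨Q, hQdeg, hQa, hQb, hQc, hQev⟩ := exists_polynomial_count_topThree (show 3 ≤ l + 3 by omega)
  have hPQ : P = Q := cr_poly_ext fun d => by rw [← hPev d, hQev d]
  rw [show l + 3 - 1 = l + 2 by omega] at hQb
  rw [show l + 3 - 2 = l + 1 by omega, show l + 3 - 3 = l by omega] at hQc
  refine ⟨Q, hQdeg, hQa, hQb, hQc, ?_, hQev⟩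
  have hG1 := card_badClass_deficiency_two l
  have hf0 : (l.factorial : ℚ) ≠ 0 := by exact_mod_cast l.factorial_ne_zero
  have hf1 : ((l + 1).factorial : ℚ) ≠ 0 := by exact_mod_cast (l + 1).factorial_ne_zero
  have e3 := cr_six_mul_choose_three (l + 2)
  have e2 := cr_two_mul_choose_two (l + 1)
  have q0 : (l.factorial : ℚ) * 2 ^ l * (((l : ℚ) + 3) ^ 3 - 9 * ((l : ℚ) + 3) ^ 2 + 29 * ((l : ℚ) + 3) - 40) / (l.factorial : ℚ) =
      2 ^ l * (((l : ℚ) + 3) ^ 3 - 9 * ((l : ℚ) + 3) ^ 2 + 29 * ((l : ℚ) + 3) - 40) := by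
    rw [div_eq_iff hf0]; ring
  have q1 : ((l + 1).factorial : ℚ) * 2 ^ (l + 1) * (l : ℚ) / ((l + 1).factorial : ℚ) = 2 ^ (l + 1) * (l : ℚ) := by
    rw [div_eq_iff hf1]; ring
  rw [← hPQ, hP0, hG, hG1, q0, q1]
  push_cast at e2 e3 ⊢
  linear_combination (-(8 : ℚ) * 2 ^ l) * e3 + ((48 : ℚ) * 2 ^ l * (l : ℚ)) * e2

end CountCensus

section SpanTwoCensus

/-- ★★ REDUCTION OF THE CENSUS LAW (L2′) TO ONE AXIS-CLASS COUNT: for `c = m + 3`, IF the irreducible bridges of `ℤ^{m+1}` of cost `c` and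
span two using every lateral axis (the SECOND axis class of the span-two cell, `u = c − 3`) number
`F_{c,c+2}(c−3) = (c−3)!·2^{c−3}·(c⁵ − 12c⁴ + 59c³ − 162c² + 276c − 234)/6`, THEN `d ↦ N_{c,c+2}(ℤ^{d+1})` is a polynomial of degree
`≤ c − 2` with `[d^{c−2}] = C(c−1,3)·2^{c−2}` (the top class, `card_spanTwoTopClass`) AND `48·[d^{c−3}] N_{c,c+2} = −2^c(c⁴ − 12c³ + 65c² −
180c + 198)` — the lane's law (L2′) at this `c`. [cite: MadrasSlade1993, §1.1 eq. (1.1.8) p. 5; §4.2 eq. (4.2.20)–(4.2.22); lane theorem] -/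
theorem exists_polynomial_costCoeffZd_spanTwo_topFour_of_card (m : ℕ)
    (hF : (((irreducibleBridges (m + 1) (m + 5)).filter fun (ω : ℕ → Site (m + 1)) => costZd m (m + 5) ω = m + 3 ∧
        ∀ a : Fin (m + 1), a ≠ 0 → ∃ i ≤ m + 5, ω i a ≠ (0 : ℤ)).card : ℚ) =
      (m.factorial : ℚ) * 2 ^ m * ((((m : ℚ) + 3) ^ 5 - 12 * ((m : ℚ) + 3) ^ 4 + 59 * ((m : ℚ) + 3) ^ 3 - 162 * ((m : ℚ) + 3) ^ 2 +
        276 * ((m : ℚ) + 3) - 234) / 6)) :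
    ∃ P : Polynomial ℚ, P.natDegree ≤ m + 1 ∧ P.coeff (m + 1) = (((m + 2).choose 3 : ℕ) : ℚ) * (2 : ℚ) ^ (m + 1) ∧
      48 * P.coeff m = -(2 : ℚ) ^ (m + 3) *
        (((m + 3 : ℕ) : ℚ) ^ 4 - 12 * ((m + 3 : ℕ) : ℚ) ^ 3 + 65 * ((m + 3 : ℕ) : ℚ) ^ 2 - 180 * ((m + 3 : ℕ) : ℚ) + 198) ∧
      ∀ d : ℕ, (costCoeffZd d (m + 3) (m + 5) : ℚ) = P.eval (d : ℚ) := by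
  classical
  set F : ℕ → ℕ := fun u => ((irreducibleBridges (u + 1) (m + 5)).filter fun (ω : ℕ → Site (u + 1)) =>
      costZd u (m + 5) ω = m + 3 ∧ ∀ a : Fin (u + 1), a ≠ 0 → ∃ i ≤ m + 5, ω i a ≠ (0 : ℤ)).card with hFdef
  have hNF : ∀ d, costCoeffZd d (m + 3) (m + 5) = ∑ u ∈ Finset.range (m + 3 + 1), d.choose u * F u := fun d =>
    costCoeffZd_eq_sum_choose_mul d (m + 3) (m + 5)
  have hFz : ∀ u, m + 1 < u → F u = 0 := fun u hu => card_allAxesClass_eq_zero_of_lt (by omega)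
  have hFtop : F (m + 1) = 2 ^ (m + 1) * (m + 1).factorial * (m + 2).choose 3 := card_spanTwoTopClass (m + 1)
  have hFm : F m = ((irreducibleBridges (m + 1) (m + 5)).filter fun (ω : ℕ → Site (m + 1)) => costZd m (m + 5) ω = m + 3 ∧
      ∀ a : Fin (m + 1), a ≠ 0 → ∃ i ≤ m + 5, ω i a ≠ (0 : ℤ)).card := rfl
  set P : Polynomial ℚ := ∑ u ∈ Finset.range (m + 2), Polynomial.C ((F u : ℚ) / (u.factorial : ℚ)) * descPochhammer ℚ u with hP
  have hBcoeff : ∀ k u, u < k → (Polynomial.C ((F u : ℚ) / (u.factorial : ℚ)) * descPochhammer ℚ u).coeff k = 0 := by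
    intro k u huk
    rw [Polynomial.coeff_C_mul, Polynomial.coeff_eq_zero_of_natDegree_lt, mul_zero]
    rw [descPochhammer_natDegree]; exact huk
  refine ⟨P, ?_, ?_, ?_, ?_⟩
  · refine Polynomial.natDegree_sum_le_of_forall_le _ _ fun u hu => ?_
    calc (Polynomial.C ((F u : ℚ) / (u.factorial : ℚ)) * descPochhammer ℚ u).natDegree
        ≤ (descPochhammer ℚ u).natDegree := Polynomial.natDegree_C_mul_le _ _
      _ = u := descPochhammer_natDegree ℚ u
      _ ≤ m + 1 := by have := Finset.mem_range.1 hu; omega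
  · rw [hP, Polynomial.finsetSum_coeff, Finset.sum_range_succ, Finset.sum_eq_zero (fun u hu => hBcoeff (m + 1) u
      (Finset.mem_range.1 hu)), zero_add, Polynomial.coeff_C_mul, cr_descPochhammer_coeff_self, mul_one, hFtop]
    have hf1 : ((m + 1).factorial : ℚ) ≠ 0 := by exact_mod_cast (m + 1).factorial_ne_zero
    field_simp
    push_cast
    ring
  · rw [hP, Polynomial.finsetSum_coeff, Finset.sum_range_succ, Finset.sum_range_succ, Finset.sum_eq_zero (fun u hu => hBcoeff m u
      (Finset.mem_range.1 hu)), zero_add, Polynomial.coeff_C_mul, cr_descPochhammer_coeff_self, mul_one, Polynomial.coeff_C_mul,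
      cr_descPochhammer_coeff_pred, hFtop, hFm, hF]
    have hf0 : (m.factorial : ℚ) ≠ 0 := by exact_mod_cast m.factorial_ne_zero
    have hf1 : ((m + 1).factorial : ℚ) ≠ 0 := by exact_mod_cast (m + 1).factorial_ne_zero
    have e3 := cr_six_mul_choose_three (m + 2)
    have e2 := cr_two_mul_choose_two (m + 1)
    have q0 : (m.factorial : ℚ) * 2 ^ m * ((((m : ℚ) + 3) ^ 5 - 12 * ((m : ℚ) + 3) ^ 4 + 59 * ((m : ℚ) + 3) ^ 3 -
        162 * ((m : ℚ) + 3) ^ 2 + 276 * ((m : ℚ) + 3) - 234) / 6) / (m.factorial : ℚ) =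
        2 ^ m * ((((m : ℚ) + 3) ^ 5 - 12 * ((m : ℚ) + 3) ^ 4 + 59 * ((m : ℚ) + 3) ^ 3 -
        162 * ((m : ℚ) + 3) ^ 2 + 276 * ((m : ℚ) + 3) - 234) / 6) := by
      rw [div_eq_iff hf0]; ring
    have hq : ((2 ^ (m + 1) * (m + 1).factorial * (m + 2).choose 3 : ℕ) : ℚ) / ((m + 1).factorial : ℚ) =
        2 ^ (m + 1) * (((m + 2).choose 3 : ℕ) : ℚ) := by
      rw [div_eq_iff hf1]; push_cast; ring
    rw [q0, hq]
    push_cast at e2 e3 ⊢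
    linear_combination (-(8 : ℚ) * 2 ^ m * (((m : ℚ) + 1) * ((m : ℚ) + 1 - 1))) * e3 +
      (-(48 : ℚ) * 2 ^ m * (((m + 2).choose 3 : ℕ) : ℚ)) * e2
  · intro d
    rw [hNF d, hP, Polynomial.eval_finsetSum]
    rw [show Finset.range (m + 3 + 1) = Finset.range (m + 2 + 2) by rfl, Finset.sum_range_succ, Finset.sum_range_succ,
      hFz (m + 2) (by omega), hFz (m + 3) (by omega)]
    push_cast
    simp only [mul_zero, add_zero]
    refine Finset.sum_congr rfl fun u _ => ?_
    have hf : (u.factorial : ℚ) ≠ 0 := by exact_mod_cast u.factorial_ne_zero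
    rw [Polynomial.eval_mul, Polynomial.eval_C, descPochhammer_eval_eq_descFactorial ℚ d u,
      Nat.descFactorial_eq_factorial_mul_choose, Nat.cast_mul, div_mul_eq_mul_div, mul_div_assoc,
      mul_div_cancel_left₀ _ hf, mul_comm]

end SpanTwoCensus

section Assembly

/-- ★★★ Am. BC's FOURTH-SYMBOL LAW FROM TWO AXIS-CLASS COUNTS. IF (G) for every `n = l + 3 ≥ 5` the non-self-avoiding memory-2 walks of length
`n` on `ℤ^{n−3}` using every axis number `(n−3)!·2^{n−3}·(n³ − 9n² + 29n − 40)` and (F) for every `c = m + 3 ≥ 4` the irreducible bridges of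
`ℤ^{c−2}` of cost `c` and length `c + 2` using every lateral axis number `(c−3)!·2^{c−3}·(c⁵ − 12c⁴ + 59c³ − 162c² + 276c − 234)/6`, THEN for every
`k ≥ 3` the large-force coefficient `d ↦ c_k^{(d)}` of the pulled self-avoiding walk on `ℤ^{d+1}` is a polynomial of degree `k − 1` with
`[d^{k−1}] = (−2)^{k−1}`, `[d^{k−2}] = (−1)^{k−1}2^{k−2}(k² − 5k + 7)` and `[d^{k−3}] c_k^{(d)} = (−1)^{k−1}2^{k−3}(k−3)(k−4)(5k²−35k+56)/12`.
Proof: (G) ⇒ the census law (L1) (`exists_polynomial_count_topFour_of_card_badClass`), (F) ⇒ (L2′) (`exists_polynomial_costCoeffZd_spanTwo_topFour_of_card`),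
and the collapse `exists_polynomial_largeForceCoeffZd_thirdCoeff_of_census_laws`. The two counts are finite combinatorial statements about
canonical axis words (lane FINDING-ZD-FOURTH-SYMBOL §1–§2 and DESIGN-ZD-CENSUS-LAW-L1: `n³−9n²+29n−40 = 4(n−4)² + (n−5)²(n−3) + (n−4) + (n−5) + 4(n−5)`
by loop signature, verified by exhaustive enumeration for `n ≤ 10`; `canon(c)` verified for `c ≤ 17`) — HYPOTHESES here, the next cars.
[cite: MadrasSlade1993, §1.1 eq. (1.1.8) p. 5; §1.2 p. 10; §4.2 eq. (4.2.20)–(4.2.22)] [cite: ClisbyLiangSlade2007, §1.3 eq. (1)/(3); lane theorem] -/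
theorem exists_polynomial_largeForceCoeffZd_thirdCoeff_of_axisClass_counts
    (hG : ∀ l : ℕ, 2 ≤ l → (((memWalks l 2 (l + 3)).filter fun (ω : ℕ → Site l) =>
        (∃ i ≤ l + 3, ∃ j ≤ l + 3, i < j ∧ ω i = ω j) ∧ ∀ a : Fin l, ∃ i ≤ l + 3, ω i a ≠ (0 : ℤ)).card : ℚ) =
      (l.factorial : ℚ) * 2 ^ l * (((l : ℚ) + 3) ^ 3 - 9 * ((l : ℚ) + 3) ^ 2 + 29 * ((l : ℚ) + 3) - 40))
    (hF : ∀ m : ℕ, 1 ≤ m → (((irreducibleBridges (m + 1) (m + 5)).filter fun (ω : ℕ → Site (m + 1)) => costZd m (m + 5) ω = m + 3 ∧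
        ∀ a : Fin (m + 1), a ≠ 0 → ∃ i ≤ m + 5, ω i a ≠ (0 : ℤ)).card : ℚ) =
      (m.factorial : ℚ) * 2 ^ m * ((((m : ℚ) + 3) ^ 5 - 12 * ((m : ℚ) + 3) ^ 4 + 59 * ((m : ℚ) + 3) ^ 3 - 162 * ((m : ℚ) + 3) ^ 2 +
        276 * ((m : ℚ) + 3) - 234) / 6))
    {k : ℕ} (hk : 3 ≤ k) :
    ∃ P : Polynomial ℚ, P.natDegree = k - 1 ∧ P.leadingCoeff = (-2 : ℚ) ^ (k - 1) ∧
      P.coeff (k - 2) = (-1 : ℚ) ^ (k - 1) * 2 ^ (k - 2) * ((k : ℚ) ^ 2 - 5 * k + 7) ∧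
      P.coeff (k - 3) = (-1 : ℚ) ^ (k - 1) * 2 ^ (k - 3) * (((k : ℚ) - 3) * ((k : ℚ) - 4) * (5 * (k : ℚ) ^ 2 - 35 * (k : ℚ) + 56)) / 12 ∧
      ∀ d : ℕ, (largeForceCoeffZd d k : ℚ) = P.eval (d : ℚ) := by
  classical
  -- the census polynomials, chosen once for every cell
  have hT : ∀ c : ℕ, 3 ≤ c → ∃ P : Polynomial ℚ, P.natDegree ≤ c ∧ ∀ d : ℕ, (count d c : ℚ) = P.eval (d : ℚ) := fun c hc => by
    obtain ⟨P, hP, -, -, -, hev⟩ := exists_polynomial_count_topThree hc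
    exact ⟨P, hP, hev⟩
  have hS : ∀ c : ℕ, 4 ≤ c → ∃ P : Polynomial ℚ, P.natDegree ≤ c - 2 ∧
      48 * P.coeff (c - 3) = -(2 : ℚ) ^ c * ((c : ℚ) ^ 4 - 12 * (c : ℚ) ^ 3 + 65 * (c : ℚ) ^ 2 - 180 * (c : ℚ) + 198) ∧
      ∀ d : ℕ, (costCoeffZd d c (c + 2) : ℚ) = P.eval (d : ℚ) := by
    intro c hc
    obtain ⟨m, rfl⟩ : ∃ m, c = m + 3 := ⟨c - 3, by omega⟩
    obtain ⟨P, hP, -, hlaw, hev⟩ := exists_polynomial_costCoeffZd_spanTwo_topFour_of_card m (hF m (by omega))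
    refine ⟨P, by rw [show m + 3 - 2 = m + 1 by omega]; exact hP, ?_, fun d => by rw [show m + 3 + 2 = m + 5 by omega]; exact hev d⟩
    rw [show m + 3 - 3 = m by omega, hlaw]
  let t : ℕ → ℚ := fun c => if h : 3 ≤ c then (Classical.choose (hT c h)).coeff (c - 3) else 0
  let s : ℕ → ℚ := fun c => if h : 4 ≤ c then (Classical.choose (hS c h)).coeff (c - 3) else 0
  have ht : ∀ c : ℕ, 3 ≤ c → ∃ P : Polynomial ℚ, P.natDegree ≤ c ∧ P.coeff (c - 3) = t c ∧
      ∀ d : ℕ, (count d c : ℚ) = P.eval (d : ℚ) := by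
    intro c hc
    obtain ⟨hP, hev⟩ := Classical.choose_spec (hT c hc)
    exact ⟨_, hP, by simp only [t, dif_pos hc], hev⟩
  have hs : ∀ c : ℕ, 4 ≤ c → ∃ P : Polynomial ℚ, P.natDegree ≤ c - 2 ∧ P.coeff (c - 3) = s c ∧
      ∀ d : ℕ, (costCoeffZd d c (c + 2) : ℚ) = P.eval (d : ℚ) := by
    intro c hc
    obtain ⟨hP, -, hev⟩ := Classical.choose_spec (hS c hc)
    exact ⟨_, hP, by simp only [s, dif_pos hc], hev⟩
  have htlaw : ∀ c : ℕ, 5 ≤ c → 48 * t c = -(2 : ℚ) ^ c * ((c : ℚ) ^ 3 - 12 * (c : ℚ) ^ 2 + 59 * (c : ℚ) - 138) := by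
    intro c hc
    have hc3 : 3 ≤ c := by omega
    obtain ⟨-, hev₁⟩ := Classical.choose_spec (hT c hc3)
    obtain ⟨l, rfl⟩ : ∃ l, c = l + 3 := ⟨c - 3, by omega⟩
    obtain ⟨P₂, -, -, -, -, hlaw, hev₂⟩ := exists_polynomial_count_topFour_of_card_badClass l (hG l (by omega))
    have hPP : Classical.choose (hT (l + 3) hc3) = P₂ := cr_poly_ext fun d => by rw [← hev₁ d, hev₂ d]
    simp only [t, dif_pos hc3]
    rw [hPP, show l + 3 - 3 = l by omega, hlaw]
  have hslaw : ∀ c : ℕ, 4 ≤ c → 48 * s c = -(2 : ℚ) ^ c * ((c : ℚ) ^ 4 - 12 * (c : ℚ) ^ 3 + 65 * (c : ℚ) ^ 2 - 180 * (c : ℚ) + 198) := by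
    intro c hc
    obtain ⟨-, hlaw, -⟩ := Classical.choose_spec (hS c hc)
    simp only [s, dif_pos hc]
    exact hlaw
  exact exists_polynomial_largeForceCoeffZd_thirdCoeff_of_census_laws t s ht hs htlaw hslaw hk

end Assembly

end Literature.Probability.RandomPlanarGeometry.SAW.Zd
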